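import Summits.Ventures.LatticeQCDFlow.Scoring.OnePlaquetteSU3HaarBridge
import Summits.Ventures.LatticeQCDFlow.Scoring.OnePlaquetteSU3PlaquetteVariance
import HarnessLib

/-!
# SU(3) Haar moments and the plaquette variance on the Haar side (given Weyl's formula)

HONEST FRAMING: exact (Metropolis-corrected) sampling algorithms for lattice gauge theory;
figures of merit are autocorrelation/cost numbers at stated couplings and volumes; no
continuum-physics claim.

Venture `LatticeQCDFlow` (cell pub-lqcd), sub-topic `Scoring`; FANOUT row 5 (`s0-sun-a`), GEN-16.
NEW WORK of the cell (placement rule); corollaries of the conditional Haar bridge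
(`OnePlaquetteSU3HaarBridge.integral_haar_su3_traceFun_eq_integral2`,
`haar_su3_expect_eq_onePlaquetteExpectSU3`), CONDITIONAL on the tree's named fact
`hW : weylIntegralFormula_specialUnitary (Fin 3)` (Bröcker–tom Dieck IV (1.11)):

* §1 **the first three Haar moments of `Re tr U` on `SU(3)`** — `∫ Re tr U dU = 0`,
  `∫ (Re tr U)² dU = 1/2`, `∫ (Re tr U)³ dU = 1/4` (GEN-6's torus moments
  `OnePlaquetteSU3Moments.integral2_weylSU3_mul_reTrSU3[_sq,_cube]`, i.e. `∫ tr U = 0`,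
  `∫ |tr U|² = 1`, `∫ (tr U)³ = 1` read through `Re`); these are the classical invariant counts of
  `3 ⊗ 3̄` and `3 ⊗ 3 ⊗ 3` and serve as a normalisation check of the named fact (`6 = |W|`,
  `(2π)⁻²`): a misnormalised `hW` would contradict `∫ 1 dU = 1` — `integral_haar_su3_one` re-derives
  `1 = 1` through the bridge;
* §2 **the Haar one-plaquette second moment and variance at the S0-C point**: the Haar expectation
  of `plaq² = ((1/3) Re tr U)²` under `e^{−β(3 − Re tr U)} dU` is GEN-16's
  `onePlaquetteExpectSU3 (3β) (plaq·plaq)`, so at theory-2 coupling `5/3` (table `β = 5`)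
  `0.071934473027 ≤ Var^{Haar}(plaq) ≤ 0.071934473030` (`OnePlaquetteSU3PlaquetteVariance`).

Nothing is cited as a fact beyond `hW`; no `def`.
-/

noncomputable section

open Real MeasureTheory
open Literature.MathematicalPhysics.QuantumFieldTheory (haarProbability)
open Literature.MathematicalPhysics.QuantumLattice
open Literature.RepresentationTheory.CompactGroups

namespace Summit.Ventures.LatticeQCDFlow.Scoring

/-! ### 1. Haar moments of `Re tr U` on `SU(3)` -/

/-- Normalisation check: through the bridge, `∫_{SU(3)} 1 dU = (1/(6(2π)²)) ∫∫ |Δ|² = 1`. -/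
theorem integral_haar_su3_one (hW : weylIntegralFormula_specialUnitary (Fin 3)) :
    ∫ U, (fun _ : ℝ => (1 : ℝ)) ((U : Matrix.specialUnitaryGroup (Fin 3) ℂ) :
        Matrix (Fin 3) (Fin 3) ℂ).trace.re
      ∂(haarProbability (Matrix.specialUnitaryGroup (Fin 3) ℂ)) = 1 := by
  rw [integral_haar_su3_traceFun_eq_integral2 hW (fun _ => (1 : ℝ)) continuous_const]
  simp only [one_mul]
  rw [integral2_weylSU3]
  have hπ : (2 * π : ℝ) ^ 2 ≠ 0 := by positivity
  field_simp

/-- **`∫_{SU(3)} Re tr U dU = 0`** (given Weyl's formula; GEN-6: `∫∫ |Δ|² Re tr U = 0`). -/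
theorem integral_haar_su3_trace_re (hW : weylIntegralFormula_specialUnitary (Fin 3)) :
    ∫ U, ((U : Matrix.specialUnitaryGroup (Fin 3) ℂ) : Matrix (Fin 3) (Fin 3) ℂ).trace.re
        ∂(haarProbability (Matrix.specialUnitaryGroup (Fin 3) ℂ)) = 0 := by
  have h := integral_haar_su3_traceFun_eq_integral2 hW (fun t => t) continuous_id
  rw [h]
  have hpt : ∀ θ₁ θ₂ : ℝ, reTrSU3 θ₁ θ₂ * weylSU3 θ₁ θ₂ = weylSU3 θ₁ θ₂ * reTrSU3 θ₁ θ₂ :=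
    fun θ₁ θ₂ => mul_comm _ _
  simp_rw [hpt]
  rw [integral2_weylSU3_mul_reTrSU3, mul_zero]

/-- **`∫_{SU(3)} (Re tr U)² dU = 1/2`** (given Weyl's formula; GEN-6: `∫∫ |Δ|² (Re tr U)² = 3(2π)²`;
classically `∫ |tr U|² dU = 1`, the fundamental representation being irreducible). -/
theorem integral_haar_su3_trace_re_sq (hW : weylIntegralFormula_specialUnitary (Fin 3)) :
    ∫ U, ((U : Matrix.specialUnitaryGroup (Fin 3) ℂ) : Matrix (Fin 3) (Fin 3) ℂ).trace.re ^ 2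
        ∂(haarProbability (Matrix.specialUnitaryGroup (Fin 3) ℂ)) = 1 / 2 := by
  have h := integral_haar_su3_traceFun_eq_integral2 hW (fun t => t ^ 2) (continuous_pow 2)
  rw [h]
  have hpt : ∀ θ₁ θ₂ : ℝ, reTrSU3 θ₁ θ₂ ^ 2 * weylSU3 θ₁ θ₂ = weylSU3 θ₁ θ₂ * reTrSU3 θ₁ θ₂ ^ 2 :=
    fun θ₁ θ₂ => mul_comm _ _
  simp_rw [hpt]
  rw [integral2_weylSU3_mul_reTrSU3_sq]
  have hπ : (2 * π : ℝ) ^ 2 ≠ 0 := by positivity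
  field_simp
  ring

/-- **`∫_{SU(3)} (Re tr U)³ dU = 1/4`** (given Weyl's formula; GEN-6:
`∫∫ |Δ|² (Re tr U)³ = (3/2)(2π)²`; classically `∫ (tr U)³ dU = 1`, the one cubic invariant `det`). -/
theorem integral_haar_su3_trace_re_cube (hW : weylIntegralFormula_specialUnitary (Fin 3)) :
    ∫ U, ((U : Matrix.specialUnitaryGroup (Fin 3) ℂ) : Matrix (Fin 3) (Fin 3) ℂ).trace.re ^ 3
        ∂(haarProbability (Matrix.specialUnitaryGroup (Fin 3) ℂ)) = 1 / 4 := by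
  have h := integral_haar_su3_traceFun_eq_integral2 hW (fun t => t ^ 3) (continuous_pow 3)
  rw [h]
  have hpt : ∀ θ₁ θ₂ : ℝ, reTrSU3 θ₁ θ₂ ^ 3 * weylSU3 θ₁ θ₂ = weylSU3 θ₁ θ₂ * reTrSU3 θ₁ θ₂ ^ 3 :=
    fun θ₁ θ₂ => mul_comm _ _
  simp_rw [hpt]
  rw [integral2_weylSU3_mul_reTrSU3_cube]
  have hπ : (2 * π : ℝ) ^ 2 ≠ 0 := by positivity
  field_simp
  ring

/-- **ALL Haar moments of `1 + Re tr U` on `SU(3)` are GEN-6's exact rationals** (given Weyl's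
formula): `∫_{SU(3)} (1 + Re tr U)^k dU = su3Moment k / 6` (`= 1, 1, 3/2, 11/4, 23/4, 211/16, …`;
`su3Moment k = 2^{−k} Σ_v c_v T_k(a_v, b_v)`, `OnePlaquetteSU3Moments`). -/
theorem integral_haar_su3_one_add_trace_re_pow (hW : weylIntegralFormula_specialUnitary (Fin 3))
    (k : ℕ) :
    ∫ U, (1 + ((U : Matrix.specialUnitaryGroup (Fin 3) ℂ) : Matrix (Fin 3) (Fin 3) ℂ).trace.re) ^ k
        ∂(haarProbability (Matrix.specialUnitaryGroup (Fin 3) ℂ))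
      = ((su3Moment k : ℚ) : ℝ) / 6 := by
  have h := integral_haar_su3_traceFun_eq_integral2 hW (fun t => (1 + t) ^ k) (by fun_prop)
  rw [h]
  have hpt : ∀ θ₁ θ₂ : ℝ, (1 + reTrSU3 θ₁ θ₂) ^ k * weylSU3 θ₁ θ₂
      = weylSU3 θ₁ θ₂ * (1 + reTrSU3 θ₁ θ₂) ^ k := fun θ₁ θ₂ => mul_comm _ _
  simp_rw [hpt]
  rw [integral2_weylSU3_mul_pow]
  have hπ : (2 * π : ℝ) ^ 2 ≠ 0 := by positivity
  field_simp

/-! ### 2. The Haar second moment and variance of the plaquette -/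

/-- **The Haar one-plaquette second moment is the Weyl-torus one** (given Weyl's formula):
`∫ plaq² e^{−β(3 − Re tr U)} dU / ∫ e^{−β(3 − Re tr U)} dU = onePlaquetteExpectSU3 (3β) (plaq·plaq)`,
`plaq = (1/3) Re tr U`. -/
theorem haar_su3_plaqSq_eq (hW : weylIntegralFormula_specialUnitary (Fin 3)) (β : ℝ) :
    (∫ U, (((U : Matrix.specialUnitaryGroup (Fin 3) ℂ) : Matrix (Fin 3) (Fin 3) ℂ).trace.re / 3
          * (((U : Matrix.specialUnitaryGroup (Fin 3) ℂ) : Matrix (Fin 3) (Fin 3) ℂ).trace.re / 3))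
          * Real.exp (-(β * (3 - ((U : Matrix.specialUnitaryGroup (Fin 3) ℂ) : Matrix (Fin 3) (Fin 3) ℂ).trace.re)))
        ∂(haarProbability (Matrix.specialUnitaryGroup (Fin 3) ℂ)))
      / (∫ U, Real.exp (-(β * (3 - ((U : Matrix.specialUnitaryGroup (Fin 3) ℂ) :
          Matrix (Fin 3) (Fin 3) ℂ).trace.re)))
        ∂(haarProbability (Matrix.specialUnitaryGroup (Fin 3) ℂ)))
      = onePlaquetteExpectSU3 (3 * β) (fun θ₁ θ₂ => plaqSU3 θ₁ θ₂ * plaqSU3 θ₁ θ₂) := by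
  have h := haar_su3_expect_eq_onePlaquetteExpectSU3 hW β (fun t => t / 3 * (t / 3)) (by fun_prop)
  rw [h]
  rfl

/-- **The Haar plaquette variance at the S0-C point** (given Weyl's formula): at theory-2 coupling
`β = 5/3` (table `β = 5`), `0.071934473027 ≤ ⟨plaq²⟩^{Haar} − (⟨plaq⟩^{Haar})² ≤ 0.071934473030`
(GEN-16's kernel enclosure `onePlaquetteSU3_variance_encl_5`). -/
theorem haar_su3_variance_encl_five_thirds (hW : weylIntegralFormula_specialUnitary (Fin 3)) :
    (71934473027 : ℝ) / 1000000000000 ≤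
      (∫ U, (((U : Matrix.specialUnitaryGroup (Fin 3) ℂ) : Matrix (Fin 3) (Fin 3) ℂ).trace.re / 3
            * (((U : Matrix.specialUnitaryGroup (Fin 3) ℂ) : Matrix (Fin 3) (Fin 3) ℂ).trace.re / 3))
            * Real.exp (-((5 / 3 : ℝ) * (3 - ((U : Matrix.specialUnitaryGroup (Fin 3) ℂ) :
                Matrix (Fin 3) (Fin 3) ℂ).trace.re)))
          ∂(haarProbability (Matrix.specialUnitaryGroup (Fin 3) ℂ)))
        / (∫ U, Real.exp (-((5 / 3 : ℝ) * (3 - ((U : Matrix.specialUnitaryGroup (Fin 3) ℂ) :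
                Matrix (Fin 3) (Fin 3) ℂ).trace.re)))
          ∂(haarProbability (Matrix.specialUnitaryGroup (Fin 3) ℂ)))
      - ((∫ U, ((U : Matrix.specialUnitaryGroup (Fin 3) ℂ) : Matrix (Fin 3) (Fin 3) ℂ).trace.re / 3
            * Real.exp (-((5 / 3 : ℝ) * (3 - ((U : Matrix.specialUnitaryGroup (Fin 3) ℂ) :
                Matrix (Fin 3) (Fin 3) ℂ).trace.re)))
          ∂(haarProbability (Matrix.specialUnitaryGroup (Fin 3) ℂ)))
        / (∫ U, Real.exp (-((5 / 3 : ℝ) * (3 - ((U : Matrix.specialUnitaryGroup (Fin 3) ℂ) :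
                Matrix (Fin 3) (Fin 3) ℂ).trace.re)))
          ∂(haarProbability (Matrix.specialUnitaryGroup (Fin 3) ℂ)))) ^ 2 ∧
    (∫ U, (((U : Matrix.specialUnitaryGroup (Fin 3) ℂ) : Matrix (Fin 3) (Fin 3) ℂ).trace.re / 3
            * (((U : Matrix.specialUnitaryGroup (Fin 3) ℂ) : Matrix (Fin 3) (Fin 3) ℂ).trace.re / 3))
            * Real.exp (-((5 / 3 : ℝ) * (3 - ((U : Matrix.specialUnitaryGroup (Fin 3) ℂ) :
                Matrix (Fin 3) (Fin 3) ℂ).trace.re)))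
          ∂(haarProbability (Matrix.specialUnitaryGroup (Fin 3) ℂ)))
        / (∫ U, Real.exp (-((5 / 3 : ℝ) * (3 - ((U : Matrix.specialUnitaryGroup (Fin 3) ℂ) :
                Matrix (Fin 3) (Fin 3) ℂ).trace.re)))
          ∂(haarProbability (Matrix.specialUnitaryGroup (Fin 3) ℂ)))
      - ((∫ U, ((U : Matrix.specialUnitaryGroup (Fin 3) ℂ) : Matrix (Fin 3) (Fin 3) ℂ).trace.re / 3
            * Real.exp (-((5 / 3 : ℝ) * (3 - ((U : Matrix.specialUnitaryGroup (Fin 3) ℂ) :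
                Matrix (Fin 3) (Fin 3) ℂ).trace.re)))
          ∂(haarProbability (Matrix.specialUnitaryGroup (Fin 3) ℂ)))
        / (∫ U, Real.exp (-((5 / 3 : ℝ) * (3 - ((U : Matrix.specialUnitaryGroup (Fin 3) ℂ) :
                Matrix (Fin 3) (Fin 3) ℂ).trace.re)))
          ∂(haarProbability (Matrix.specialUnitaryGroup (Fin 3) ℂ)))) ^ 2
      ≤ (71934473030 : ℝ) / 1000000000000 := by
  rw [haar_su3_plaqSq_eq hW, haar_su3_plaquette_eq hW, show (3 : ℝ) * (5 / 3) = 5 by norm_num]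
  exact onePlaquetteSU3_variance_encl_5

end Summit.Ventures.LatticeQCDFlow.Scoring
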